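import Mathlib
import HarnessLib
import Summits.CriticalPhenomena.PercolationContinuityZ3.Theorems.PercLowPointHalfSpaceCrossBushBookkeepingTransport

/-!
# Route `PercLowPointHalfSpace`, cross-bush bookkeeping (II): re-rooting the cross term at the origin

Helper file for item `stmt-CriticalPhenomena-14687` (`CrossBushBookkeeping`:
`BoundaryTwoArmDecay → TallClusterMassBound → QuantitativeBGN → E_{p_c}[N^cross_{n e₀}(U)/|U ∩ ∂ℍ|] → 0`)
of route `CriticalPhenomena/PercLowPointHalfSpace`; completes step (a) of the item's plan (the
*second floor mass transport*, here rooting the LOWER bush), for EVERY `p` and every dimension: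

* `LowPoint.lintegral_crossPinned_div_footprint_le_tsum` — **the rooted two-bush bound**: for all
  `p`, `w`,
  `E_p[N^cross_w(U)/|U ∩ ∂ℍ|] ≤ Σ_v P_p( {0,e₀} open ∧ e₀ ↔ v in ℍ₁ ∧ 0 ↔ v + w in ℍ ∧ e₀ ↮ v + w in ℍ₁ )`,
  i.e. the normalised cross-bush count is at most the expected number of cross pairs whose lower
  bush is rooted at the origin: apply the floor transport inequality
  (`lintegral_floor_transport_le`) to `Φ(ω, c) = #{cross pairs v : c roots the bush of v}`
  (`rootedCount_shift`: covariance; `measurable_rootedCount`), use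
  `N^cross ≤ Σ_{c ∈ U ∩ ∂ℍ} Φ(ω, c)` a.s. (`encard_crossPinned_le_tsum_rooted`, from
  `exists_bushRoot`) and `∫ Φ(ω,0) dP_p = Σ_v P_p(incidence at 0) ≤ Σ_v P_p(E_v(w))`
  (`rooted_subset_twoBush`).
* `tendsto_crossPinned_of_tendsto_rooted` — hence the conclusion of the item (equivalently
  `θ(p_c(ℤ³)) = 0`, by `percolationContinuityZ3_iff_crossPinnedPairs_decay` of
  `PercLowPointHalfSpaceAssemblyReduction.lean`) follows from `Σ_v P_{p_c}(E_v(n e₀)) → 0`: the genuinely two-bush statement (a bush rooted AT the origin and a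
  disjoint tall bush of the same half-space cluster) that the cruxes A, B, C are meant to control in
  steps (b), (c) of the plan — NOT proved here.

Sources: R. Lyons – Y. Peres, *Probability on Trees and Networks* (2016), §8.2 (mass-transport
principle); the bush/root device is the route card's (`lowpoint-identity-halfspace-pinned-pairs`).
-/

noncomputable section

namespace Summit.CriticalPhenomena.PercolationContinuityZ3.Theorems

open MeasureTheory Filter Topology
open Literature.Probability.Percolation Literature.Probability.LatticeModels
open scoped ENNReal

namespace LowPoint

variable {d : ℕ} [NeZero d]

/-! ## The rooted two-bush bound -/

omit [NeZero d] in
/-- `Σ_v 𝟙_s(v) = |s|` in `ℝ≥0∞`. [folklore] -/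
theorem tsum_indicator_one_eq_encard (s : Set (Site d)) :
    ∑' v, s.indicator (1 : Site d → ℝ≥0∞) v = ((s.encard : ℕ∞) : ℝ≥0∞) := by
  rw [← tsum_subtype]
  exact ENNReal.tsum_set_one s

/-- Pointwise: the number of cross pairs is at most the number of (cross pair, root of its lower
bush in `U ∩ ∂ℍ`) incidences, `N^cross_w ≤ Σ_{c ∈ U ∩ ∂ℍ} #{cross pairs v : c roots the bush of v}`
(every cross pair has at least one such root, `exists_bushRoot`). [folklore] -/
theorem encard_crossPinned_le_tsum_rooted {ω : BondConfig (Site d)} (hω : ω ⊆ (zdGraph d).edgeSet)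
    (w : Site d) :
    (((halfSpacePinnedPairs ω w ∩ {v : Site d | 1 ≤ v 0}).encard : ℕ∞) : ℝ≥0∞) ≤
      ∑' c, (halfSpaceCluster ω ∩ {x | x 0 = 0}).indicator (fun c =>
        ((({v : Site d | v ∈ halfSpacePinnedPairs ω w ∩ {v : Site d | 1 ≤ v 0} ∧
            (c 0 = 0 ∧ s(c, c + Pi.single 0 1) ∈ ω ∧
              ω ∈ openConnIn {x : Site d | 1 ≤ x 0} (c + Pi.single 0 1) v)}).encard : ℕ∞) :
          ℝ≥0∞)) c := by
  -- the incidence indicator, as a product of two indicators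
  set g : Site d → Site d → ℝ≥0∞ := fun c v =>
    (halfSpaceCluster ω ∩ {x | x 0 = 0}).indicator (1 : Site d → ℝ≥0∞) c *
      {v : Site d | v ∈ halfSpacePinnedPairs ω w ∩ {v : Site d | 1 ≤ v 0} ∧
        (c 0 = 0 ∧ s(c, c + Pi.single 0 1) ∈ ω ∧
          ω ∈ openConnIn {x : Site d | 1 ≤ x 0} (c + Pi.single 0 1) v)}.indicator
        (1 : Site d → ℝ≥0∞) v with hg
  -- the right-hand side is `Σ_c Σ_v g c v`
  have hrhs : ∀ c, (halfSpaceCluster ω ∩ {x | x 0 = 0}).indicator (fun c =>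
      ((({v : Site d | v ∈ halfSpacePinnedPairs ω w ∩ {v : Site d | 1 ≤ v 0} ∧
          (c 0 = 0 ∧ s(c, c + Pi.single 0 1) ∈ ω ∧
            ω ∈ openConnIn {x : Site d | 1 ≤ x 0} (c + Pi.single 0 1) v)}).encard : ℕ∞) :
        ℝ≥0∞)) c = ∑' v, g c v := by
    intro c
    by_cases hc : c ∈ halfSpaceCluster ω ∩ {x | x 0 = 0}
    · rw [Set.indicator_of_mem hc, ← tsum_indicator_one_eq_encard]
      refine tsum_congr fun v => ?_
      simp only [hg]
      rw [Set.indicator_of_mem hc, Pi.one_apply, one_mul]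
    · rw [Set.indicator_of_notMem hc]
      symm
      refine ENNReal.tsum_eq_zero.2 fun v => ?_
      simp only [hg]
      rw [Set.indicator_of_notMem hc, zero_mul]
  rw [tsum_congr hrhs, ENNReal.tsum_comm]
  -- for a cross pair `v`, the inner sum over `c` is at least `1`
  have hlow : ∀ v, (halfSpacePinnedPairs ω w ∩ {v : Site d | 1 ≤ v 0}).indicator
      (1 : Site d → ℝ≥0∞) v ≤ ∑' c, g c v := by
    intro v
    by_cases hv : v ∈ halfSpacePinnedPairs ω w ∩ {v : Site d | 1 ≤ v 0}
    · obtain ⟨c, hcU, hc0, hce, hcv⟩ := exists_bushRoot hω hv.1.1 hv.2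
      rw [Set.indicator_of_mem hv, Pi.one_apply]
      refine le_trans (le_of_eq ?_) (ENNReal.le_tsum c)
      simp only [hg]
      rw [Set.indicator_of_mem (show c ∈ halfSpaceCluster ω ∩ {x | x 0 = 0} from ⟨hcU, hc0⟩),
        Set.indicator_of_mem (show v ∈ {v : Site d | v ∈ halfSpacePinnedPairs ω w ∩
          {v : Site d | 1 ≤ v 0} ∧ (c 0 = 0 ∧ s(c, c + Pi.single 0 1) ∈ ω ∧
            ω ∈ openConnIn {x : Site d | 1 ≤ x 0} (c + Pi.single 0 1) v)} from
              ⟨hv, hc0, hce, hcv⟩), Pi.one_apply, Pi.one_apply, one_mul]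
    · rw [Set.indicator_of_notMem hv]
      exact zero_le
  calc (((halfSpacePinnedPairs ω w ∩ {v : Site d | 1 ≤ v 0}).encard : ℕ∞) : ℝ≥0∞)
      = ∑' v, (halfSpacePinnedPairs ω w ∩ {v : Site d | 1 ≤ v 0}).indicator
          (1 : Site d → ℝ≥0∞) v := (tsum_indicator_one_eq_encard _).symm
    _ ≤ ∑' v, ∑' c, g c v := ENNReal.tsum_le_tsum hlow

/-- The (cross pair, root) incidence event is measurable in `ω`. [folklore] -/
theorem measurableSet_rooted (w c v : Site d) :
    MeasurableSet {ω : BondConfig (Site d) | v ∈ halfSpacePinnedPairs ω w ∩ {v : Site d | 1 ≤ v 0} ∧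
      (c 0 = 0 ∧ s(c, c + Pi.single 0 1) ∈ ω ∧
        ω ∈ openConnIn {x : Site d | 1 ≤ x 0} (c + Pi.single 0 1) v)} :=
  measurableSet_setOf.2 <|
    ((measurable_set_iff.1 (measurable_halfSpacePinnedPairs w) v).and measurable_const).and
      (measurable_const.and ((measurable_set_mem _).and
        (measurableSet_setOf.1 (measurableSet_openConnIn_of_countable _ _ _))))

/-- `ω ↦ #{cross pairs v : c roots the bush of v}` is measurable. [folklore] -/
theorem measurable_rootedCount (w c : Site d) :
    Measurable fun ω : BondConfig (Site d) =>
      ((({v : Site d | v ∈ halfSpacePinnedPairs ω w ∩ {v : Site d | 1 ≤ v 0} ∧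
          (c 0 = 0 ∧ s(c, c + Pi.single 0 1) ∈ ω ∧
            ω ∈ openConnIn {x : Site d | 1 ≤ x 0} (c + Pi.single 0 1) v)}).encard : ℕ∞) :
        ℝ≥0∞) :=
  (Measurable.of_discrete (f := fun n : ℕ∞ => (n : ℝ≥0∞))).comp
    (measurable_encard.comp (measurable_set_iff.2 fun v =>
      measurableSet_setOf.1 (measurableSet_rooted w c v)))

/-- **Covariance of the rooted count under re-rooting**: counted in the configuration `ω - c`
(`c ∈ U(ω) ∩ ∂ℍ`), the cross pairs rooted at the origin are the translates by `-c` of the cross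
pairs of `ω` rooted at `c`. [folklore] -/
theorem rootedCount_shift {ω : BondConfig (Site d)} {c : Site d} (hc : c ∈ halfSpaceCluster ω)
    (hc0 : c 0 = 0) (w : Site d) :
    ((({v : Site d | v ∈ halfSpacePinnedPairs ((BondConfig.relabel (sym2Equiv (Site.shift (-c))) ω)) w ∩ {v : Site d | 1 ≤ v 0} ∧
        ((0 : Site d) 0 = 0 ∧ s((0 : Site d), 0 + Pi.single 0 1) ∈ (BondConfig.relabel (sym2Equiv (Site.shift (-c))) ω) ∧
          (BondConfig.relabel (sym2Equiv (Site.shift (-c))) ω) ∈ openConnIn {x : Site d | 1 ≤ x 0} (0 + Pi.single 0 1) v)}).encard : ℕ∞) :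
      ℝ≥0∞) =
    ((({v : Site d | v ∈ halfSpacePinnedPairs ω w ∩ {v : Site d | 1 ≤ v 0} ∧
        (c 0 = 0 ∧ s(c, c + Pi.single 0 1) ∈ ω ∧
          ω ∈ openConnIn {x : Site d | 1 ≤ x 0} (c + Pi.single 0 1) v)}).encard : ℕ∞) :
      ℝ≥0∞) := by
  have hinj := (Site.shift (-c)).injective
  have hce : c + Pi.single 0 1 + -c = 0 + Pi.single 0 1 := by abel
  -- the up-edge at the origin of `ω - c` is the up-edge at `c` of `ω`
  have hedge : s((0 : Site d), 0 + Pi.single 0 1) ∈ (BondConfig.relabel (sym2Equiv (Site.shift (-c))) ω) ↔ s(c, c + Pi.single 0 1) ∈ ω := by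
    have h := mk_add_mem_relabel_shift_iff (-c) ω c (c + Pi.single 0 1)
    rwa [add_neg_cancel, hce] at h
  -- connections inside `ℍ₁` are covariant under the floor shift
  have hconn : ∀ u, (BondConfig.relabel (sym2Equiv (Site.shift (-c))) ω) ∈ openConnIn {x : Site d | 1 ≤ x 0} (0 + Pi.single 0 1) (u + -c) ↔
      ω ∈ openConnIn {x : Site d | 1 ≤ x 0} (c + Pi.single 0 1) u := by
    intro u
    rw [← hce, shift_mem_openConnIn_iff, preimage_add_level]
    simp [hc0]
  have key : ∀ u, u + -c ∈ {v : Site d | v ∈ halfSpacePinnedPairs ((BondConfig.relabel (sym2Equiv (Site.shift (-c))) ω)) w ∩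
      {v : Site d | 1 ≤ v 0} ∧ ((0 : Site d) 0 = 0 ∧ s((0 : Site d), 0 + Pi.single 0 1) ∈ (BondConfig.relabel (sym2Equiv (Site.shift (-c))) ω) ∧
        (BondConfig.relabel (sym2Equiv (Site.shift (-c))) ω) ∈ openConnIn {x : Site d | 1 ≤ x 0} (0 + Pi.single 0 1) v)} ↔
      u ∈ {v : Site d | v ∈ halfSpacePinnedPairs ω w ∩ {v : Site d | 1 ≤ v 0} ∧
        (c 0 = 0 ∧ s(c, c + Pi.single 0 1) ∈ ω ∧
          ω ∈ openConnIn {x : Site d | 1 ≤ x 0} (c + Pi.single 0 1) v)} := by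
    intro u
    have h1 : u + -c ∈ halfSpacePinnedPairs ((BondConfig.relabel (sym2Equiv (Site.shift (-c))) ω)) w ↔ u ∈ halfSpacePinnedPairs ω w := by
      rw [halfSpacePinnedPairs_shift hc hc0 w]
      exact hinj.mem_set_image
    have h2 : (u + -c ∈ {v : Site d | 1 ≤ v 0}) ↔ (u ∈ {v : Site d | 1 ≤ v 0}) := by
      simp [hc0]
    simp only [Set.mem_setOf_eq, Set.mem_inter_iff] at h1 h2 ⊢
    rw [h1, h2, hedge, hconn u]
    simp [hc0]
  have hset : {v : Site d | v ∈ halfSpacePinnedPairs ((BondConfig.relabel (sym2Equiv (Site.shift (-c))) ω)) w ∩ {v : Site d | 1 ≤ v 0} ∧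
      ((0 : Site d) 0 = 0 ∧ s((0 : Site d), 0 + Pi.single 0 1) ∈ (BondConfig.relabel (sym2Equiv (Site.shift (-c))) ω) ∧
        (BondConfig.relabel (sym2Equiv (Site.shift (-c))) ω) ∈ openConnIn {x : Site d | 1 ≤ x 0} (0 + Pi.single 0 1) v)} =
      Site.shift (-c) '' {v : Site d | v ∈ halfSpacePinnedPairs ω w ∩ {v : Site d | 1 ≤ v 0} ∧
        (c 0 = 0 ∧ s(c, c + Pi.single 0 1) ∈ ω ∧
          ω ∈ openConnIn {x : Site d | 1 ≤ x 0} (c + Pi.single 0 1) v)} := by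
    ext v
    constructor
    · intro hv
      refine ⟨v + c, (key (v + c)).1 (by rwa [add_neg_cancel_right]), ?_⟩
      show v + c + -c = v
      rw [add_neg_cancel_right]
    · rintro ⟨u, hu, rfl⟩
      exact (key u).2 hu
  rw [hset, hinj.encard_image]

/-- The rooted incidence event at the origin is contained in the **rooted two-bush event**
`E_v(w) = { {0,e₀} open } ∩ {e₀ ↔ v in ℍ₁} ∩ {0 ↔ v + w in ℍ} ∩ {e₀ ↮ v + w in ℍ₁}`. [folklore] -/
theorem rooted_subset_twoBush (w v : Site d) :
    {ω : BondConfig (Site d) | v ∈ halfSpacePinnedPairs ω w ∩ {v : Site d | 1 ≤ v 0} ∧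
      ((0 : Site d) 0 = 0 ∧ s((0 : Site d), 0 + Pi.single 0 1) ∈ ω ∧
        ω ∈ openConnIn {x : Site d | 1 ≤ x 0} (0 + Pi.single 0 1) v)} ⊆
    {ω : BondConfig (Site d) | s((0 : Site d), Pi.single 0 1) ∈ ω} ∩
      openConnIn {x : Site d | 1 ≤ x 0} (Pi.single 0 1) v ∩
      openConnIn (halfSpace d) 0 (v + w) ∩
      (openConnIn {x : Site d | 1 ≤ x 0} (Pi.single 0 1) (v + w))ᶜ := by
  rintro ω ⟨⟨hvP, hv1⟩, -, he, hconn⟩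
  rw [zero_add] at he hconn
  obtain ⟨-, hvw, hpin⟩ := mem_halfSpacePinnedPairs_iff'.1 hvP
  have hv1' : 1 ≤ v 0 := hv1
  refine ⟨⟨⟨he, hconn⟩, mem_halfSpaceCluster_iff.1 hvw⟩, fun h => ?_⟩
  rcases hpin with h0 | hnot
  · omega
  · exact hnot (conn_trans (conn_symm hconn) h)

/-- **The rooted two-bush bound** (all `p`, all `w`, every dimension): the normalised cross-bush
count is at most the expected number of cross pairs whose lower bush is rooted at the origin,
`∫ N^cross_w(U)/|U ∩ ∂ℍ| dP_p ≤ Σ_v P_p( {0,e₀} open, e₀ ↔ v in ℍ₁, 0 ↔ v + w in ℍ, e₀ ↮ v + w in ℍ₁ )`.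
Floor mass transport (`lintegral_floor_transport_le`) applied to the rooted count
`Φ(ω,c) = #{cross pairs v : c roots the bush of v}`, using `N^cross ≤ Σ_{c ∈ U ∩ ∂ℍ} Φ(ω, c)`
(`encard_crossPinned_le_tsum_rooted`, a.s.) and `∫ Φ(ω,0) = Σ_v P(incidence) ≤ Σ_v P(E_v(w))`.
(Lyons–Peres 2016 §8.2 for the transport step.) [cite: LyonsPeres2016, §8.2] -/
theorem lintegral_crossPinned_div_footprint_le_tsum (p : unitInterval) (w : Site d) :
    ∫⁻ ω, (((halfSpacePinnedPairs ω w ∩ {v : Site d | 1 ≤ v 0}).encard : ℕ∞) : ℝ≥0∞) /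
        ((halfSpaceFootprint ω : ℕ∞) : ℝ≥0∞) ∂(bondPercolation (zdGraph d) p) ≤
      ∑' v : Site d, bondPercolation (zdGraph d) p
        ({ω : BondConfig (Site d) | s((0 : Site d), Pi.single 0 1) ∈ ω} ∩
          openConnIn {x : Site d | 1 ≤ x 0} (Pi.single 0 1) v ∩
          openConnIn (halfSpace d) 0 (v + w) ∩
          (openConnIn {x : Site d | 1 ≤ x 0} (Pi.single 0 1) (v + w))ᶜ) := by
  -- the rooted count
  set Φ : BondConfig (Site d) → Site d → ℝ≥0∞ := fun ω c =>
    ((({v : Site d | v ∈ halfSpacePinnedPairs ω w ∩ {v : Site d | 1 ≤ v 0} ∧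
        (c 0 = 0 ∧ s(c, c + Pi.single 0 1) ∈ ω ∧
          ω ∈ openConnIn {x : Site d | 1 ≤ x 0} (c + Pi.single 0 1) v)}).encard : ℕ∞) : ℝ≥0∞)
    with hΦ
  have hae : ∀ᵐ ω ∂(bondPercolation (zdGraph d) p), ω ⊆ (zdGraph d).edgeSet :=
    ProbabilityTheory.setBernoulli_ae_subset
  -- the incidence event at the origin, for each `v`
  have hS : ∀ v, MeasurableSet {ω : BondConfig (Site d) | v ∈ halfSpacePinnedPairs ω w ∩
      {v : Site d | 1 ≤ v 0} ∧ ((0 : Site d) 0 = 0 ∧ s((0 : Site d), 0 + Pi.single 0 1) ∈ ω ∧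
        ω ∈ openConnIn {x : Site d | 1 ≤ x 0} (0 + Pi.single 0 1) v)} :=
    fun v => measurableSet_rooted w 0 v
  calc ∫⁻ ω, (((halfSpacePinnedPairs ω w ∩ {v : Site d | 1 ≤ v 0}).encard : ℕ∞) : ℝ≥0∞) /
        ((halfSpaceFootprint ω : ℕ∞) : ℝ≥0∞) ∂(bondPercolation (zdGraph d) p)
      ≤ ∫⁻ ω, (∑' c, (halfSpaceCluster ω ∩ {x | x 0 = 0}).indicator (Φ ω) c) *
          (((halfSpaceFootprint ω : ℕ∞) : ℝ≥0∞))⁻¹ ∂(bondPercolation (zdGraph d) p) := by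
        refine lintegral_mono_ae ?_
        filter_upwards [hae] with ω hω
        rw [div_eq_mul_inv]
        exact mul_le_mul' (encard_crossPinned_le_tsum_rooted hω w) le_rfl
    _ ≤ ∫⁻ ω, Φ ω 0 ∂(bondPercolation (zdGraph d) p) :=
        lintegral_floor_transport_le p Φ (fun c => measurable_rootedCount w c)
          (fun ω c hc hc0 => rootedCount_shift hc hc0 w)
    _ = ∫⁻ ω, ∑' v, {ω' : BondConfig (Site d) | v ∈ halfSpacePinnedPairs ω' w ∩
          {v : Site d | 1 ≤ v 0} ∧ ((0 : Site d) 0 = 0 ∧ s((0 : Site d), 0 + Pi.single 0 1) ∈ ω' ∧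
            ω' ∈ openConnIn {x : Site d | 1 ≤ x 0} (0 + Pi.single 0 1) v)}.indicator 1 ω
          ∂(bondPercolation (zdGraph d) p) := by
        refine lintegral_congr fun ω => ?_
        simp only [hΦ]
        rw [← tsum_indicator_one_eq_encard]
        refine tsum_congr fun v => ?_
        by_cases hv : v ∈ {v : Site d | v ∈ halfSpacePinnedPairs ω w ∩ {v : Site d | 1 ≤ v 0} ∧
            ((0 : Site d) 0 = 0 ∧ s((0 : Site d), 0 + Pi.single 0 1) ∈ ω ∧
              ω ∈ openConnIn {x : Site d | 1 ≤ x 0} (0 + Pi.single 0 1) v)}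
        · rw [Set.indicator_of_mem hv, Set.indicator_of_mem (show ω ∈ {ω' : BondConfig (Site d) |
            v ∈ halfSpacePinnedPairs ω' w ∩ {v : Site d | 1 ≤ v 0} ∧ ((0 : Site d) 0 = 0 ∧
              s((0 : Site d), 0 + Pi.single 0 1) ∈ ω' ∧
                ω' ∈ openConnIn {x : Site d | 1 ≤ x 0} (0 + Pi.single 0 1) v)} from hv),
            Pi.one_apply, Pi.one_apply]
        · rw [Set.indicator_of_notMem hv, Set.indicator_of_notMem (show ω ∉ {ω' : BondConfig (Site d) |
            v ∈ halfSpacePinnedPairs ω' w ∩ {v : Site d | 1 ≤ v 0} ∧ ((0 : Site d) 0 = 0 ∧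
              s((0 : Site d), 0 + Pi.single 0 1) ∈ ω' ∧
                ω' ∈ openConnIn {x : Site d | 1 ≤ x 0} (0 + Pi.single 0 1) v)} from hv)]
    _ = ∑' v, bondPercolation (zdGraph d) p {ω : BondConfig (Site d) |
          v ∈ halfSpacePinnedPairs ω w ∩ {v : Site d | 1 ≤ v 0} ∧ ((0 : Site d) 0 = 0 ∧
            s((0 : Site d), 0 + Pi.single 0 1) ∈ ω ∧
              ω ∈ openConnIn {x : Site d | 1 ≤ x 0} (0 + Pi.single 0 1) v)} := by
        rw [lintegral_tsum fun v => ((measurable_one.indicator (hS v))).aemeasurable]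
        exact tsum_congr fun v => lintegral_indicator_one (hS v)
    _ ≤ _ := ENNReal.tsum_le_tsum fun v => measure_mono (rooted_subset_twoBush w v)

end LowPoint

/-! ## Consequence for the item: the conclusion follows from the decay of the rooted two-bush sum -/

open LowPoint in
/-- **Reduction of the cross-bush bookkeeping to the rooted two-bush sum** (`d = 3`, `p = p_c`,
`w = n e₀`): if `Σ_v P_{p_c}( {0,e₀} open, e₀ ↔ v in ℍ₁, 0 ↔ v + n e₀ in ℍ, e₀ ↮ v + n e₀ in ℍ₁ ) → 0`
as `n → ∞`, then the normalised cross-bush count `E_{p_c}[N^cross_{n e₀}(U)/|U ∩ ∂ℍ|]` tends to `0`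
(the conclusion of item `CrossBushBookkeeping`), by `lintegral_crossPinned_div_footprint_le_tsum`
and a squeeze. [folklore] -/
theorem tendsto_crossPinned_of_tendsto_rooted
    (h : Tendsto (fun n : ℕ => ∑' v : Site 3, bondPercolation (zdGraph 3) (criticalProbI 3)
      ({ω : BondConfig (Site 3) | s((0 : Site 3), Pi.single 0 1) ∈ ω} ∩
        openConnIn {x : Site 3 | 1 ≤ x 0} (Pi.single 0 1) v ∩
        openConnIn (halfSpace 3) 0 (v + Pi.single 0 (n : ℤ)) ∩
        (openConnIn {x : Site 3 | 1 ≤ x 0} (Pi.single 0 1) (v + Pi.single 0 (n : ℤ)))ᶜ))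
      atTop (𝓝 0)) :
    Tendsto (fun n : ℕ => ∫⁻ ω,
      ((((halfSpacePinnedPairs ω (Pi.single 0 (n : ℤ) : Site 3) ∩ {v : Site 3 | 1 ≤ v 0}).encard
        : ℕ∞) : ℝ≥0∞)) / ((halfSpaceFootprint ω : ℕ∞) : ℝ≥0∞)
          ∂(bondPercolation (zdGraph 3) (criticalProbI 3))) atTop (𝓝 0) :=
  tendsto_of_tendsto_of_tendsto_of_le_of_le tendsto_const_nhds h (fun _ => zero_le) fun n =>
    lintegral_crossPinned_div_footprint_le_tsum (criticalProbI 3) (Pi.single 0 (n : ℤ))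

end Summit.CriticalPhenomena.PercolationContinuityZ3.Theorems

end
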